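import Summits.ResolutionOfSingularities.ResolutionOfSingularities.Theorems.FrobeniusLadderFInjectiveMacaulayficationCIThetaTransportLog
import Summits.ResolutionOfSingularities.ResolutionOfSingularities.Theorems.FrobeniusLadderFInjectiveMacaulayficationCISmoothChart
import Mathlib.RingTheory.Ideal.Colon
import HarnessLib

/-!
# Cell-to-chart transport of Jacobian certificates (crux `FInjectiveMacaulayfication`, K-T4 / file 12b)

[OURS · L1 W4.5a] Support file for crux stmt-ResolutionOfSingularities-15315 (seat table v5, stub-6; planner rulings R11.4 /
R11.12 `CIThetaTransport`, codimension `c = 2`).  **The transport theorem** `hcert_of_cellCertificate`: let `V` be a unimodular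
exponent matrix with chart map `θ : X_j ↦ ∏ᵢ Yᵢ ^ V i j`, let `S` be a set of exceptional coordinates, and suppose the chart
equations `g₀, g₁` and polynomials `P₀, P₁` in the `X`-coordinates satisfy THE CHART IDENTITY `Y^{d_l} · g_l(Y_S = 0) = θ P_l`
(tree: `ToricChartFedder.monomial_mul_substZero_eq_theta_component`, with `P_l` the face-initial form of the defining equation
`F_l`).  Then an `X`-coordinate CELL CERTIFICATE `X^e ∈ (P₀, P₁) + (2 × 2 Jacobian minors of P)` (the statements of
`T11PlusCells` / `T4PlusCells`, checked by `CIPolyKitCells.hcert_two_torus_of_lists`) yields the `Y`-coordinate entry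
`∃ t js e', (∀ i ∈ S, e' i = 0) ∧ Y^{e'} ∈ (g_l(Y_S = 0)) + (2 × 2 minors of g(Y_S = 0))` required by the hypothesis `hcert` of
`CISmoothChart.ci_clause_of_smoothFaceCertificates` / `CIConeFiModelSmooth.ciConeFiModelRel_of_smoothFaceCertificates`.
Mechanism: pass to logarithmic minors (multiply by the columns' variables), transport them along `θ` with the logarithmic chain
rule (`CIThetaTransportLog`), and finally substitute `Yᵢ ↦ 1 (i ∈ S)` — a ring map fixing everything free of `Y_S` and sending
monomials to monomials supported off `S` (`substOne_*`).  So the finitely many CELLS of the Gröbner fan, not the cones of a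
regularising fan, carry the kernel-checked data (K-T4 size verdict, R11.12).
No definition is declared; AI-written, weaker than expert review; no statement of [claim: Hironaka2017] is used. [folklore]
-/

-- single-problem summit: the doubled namespace component is forced
set_option linter.dupNamespace false

noncomputable section

namespace Summit.ResolutionOfSingularities.ResolutionOfSingularities.Theorems.FInjectiveMacaulayfication.CIThetaTransport

open MvPolynomial

variable {k : Type} [CommRing k] {n : ℕ}

/-! ## The substitution `Yᵢ ↦ 1 (i ∈ S)` -/

/-- `Y_S ↦ 1` fixes every polynomial already free of `Y_S` (i.e. of the form `q(Y_S = 0)`). [folklore] -/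
theorem substOne_substZero (S : Finset (Fin n)) (q : MvPolynomial (Fin n) k) :
    aeval (fun i : Fin n => if i ∈ S then (1 : MvPolynomial (Fin n) k) else X i)
        (aeval (fun i : Fin n => if i ∈ S then (0 : MvPolynomial (Fin n) k) else X i) q) =
      aeval (fun i : Fin n => if i ∈ S then (0 : MvPolynomial (Fin n) k) else X i) q := by
  rw [← AlgHom.comp_apply]
  refine DFunLike.congr_fun (MvPolynomial.algHom_ext fun i => ?_) q
  rw [AlgHom.comp_apply, aeval_X]
  split_ifs with hi
  · rw [map_zero]
  · rw [aeval_X, if_neg hi]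

/-- A polynomial of the form `q(Y_S = 0)` has zero partial derivative in every direction of `S`. [folklore] -/
theorem pderiv_substZero_of_mem (S : Finset (Fin n)) {i : Fin n} (hi : i ∈ S) (q : MvPolynomial (Fin n) k) :
    pderiv i (aeval (fun i : Fin n => if i ∈ S then (0 : MvPolynomial (Fin n) k) else X i) q) = 0 := by
  induction q using MvPolynomial.induction_on with
  | C a => rw [aeval_C, algebraMap_eq, pderiv_C]
  | add p q hp hq => rw [map_add, map_add, hp, hq, add_zero]
  | mul_X p j hp =>
    rw [map_mul, aeval_X]
    split_ifs with hj
    · rw [mul_zero, map_zero]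
    · have hne : j ≠ i := fun h => hj (h ▸ hi)
      rw [Derivation.leibniz, smul_eq_mul, smul_eq_mul, hp, mul_zero, add_zero, pderiv_X, Pi.single_eq_of_ne hne, mul_zero]

/-- `Y_S ↦ 1` fixes the partial derivatives of a polynomial of the form `q(Y_S = 0)`. [folklore] -/
theorem substOne_pderiv_substZero (S : Finset (Fin n)) (i : Fin n) (q : MvPolynomial (Fin n) k) :
    aeval (fun i : Fin n => if i ∈ S then (1 : MvPolynomial (Fin n) k) else X i)
        (pderiv i (aeval (fun i : Fin n => if i ∈ S then (0 : MvPolynomial (Fin n) k) else X i) q)) =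
      pderiv i (aeval (fun i : Fin n => if i ∈ S then (0 : MvPolynomial (Fin n) k) else X i) q) := by
  by_cases hi : i ∈ S
  · rw [pderiv_substZero_of_mem S hi, map_zero]
  · rw [CISmoothChart.pderiv_substZero S hi, substOne_substZero]

/-- `Y_S ↦ 1` fixes the `2 × 2` Jacobian minors of polynomials of the form `q(Y_S = 0)`. [folklore] -/
theorem substOne_minor_substZero (S : Finset (Fin n)) (h : Fin 2 → MvPolynomial (Fin n) k) (v : Fin 2 → Fin n) :
    aeval (fun i : Fin n => if i ∈ S then (1 : MvPolynomial (Fin n) k) else X i)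
        (Matrix.of fun a l => pderiv (v a)
          (aeval (fun i : Fin n => if i ∈ S then (0 : MvPolynomial (Fin n) k) else X i) (h l))).det =
      (Matrix.of fun a l => pderiv (v a)
        (aeval (fun i : Fin n => if i ∈ S then (0 : MvPolynomial (Fin n) k) else X i) (h l))).det := by
  rw [minor_two, map_sub, map_mul, map_mul]
  simp only [substOne_pderiv_substZero]

/-- `Y_S ↦ 1` on monomials: the `S`-coordinates are erased from the exponent. [folklore] -/
theorem substOne_monomial (S : Finset (Fin n)) (m : Fin n →₀ ℕ) (c : k) :
    aeval (fun i : Fin n => if i ∈ S then (1 : MvPolynomial (Fin n) k) else X i) (monomial m c) =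
      monomial (Finsupp.equivFunOnFinite.symm fun i => if i ∈ S then 0 else m i) c := by
  rw [aeval_monomial, algebraMap_eq, monomial_eq, Finsupp.prod_fintype _ _ (fun i => by simp),
    Finsupp.prod_fintype _ _ (fun i => by simp)]
  congr 1
  refine Finset.prod_congr rfl fun i _ => ?_
  rw [Finsupp.coe_equivFunOnFinite_symm]
  split_ifs with hi
  · rw [one_pow, pow_zero]
  · rfl

/-- `Y_S ↦ 1` after the chart map sends a monomial to a monomial supported off `S`. [folklore] -/
theorem substOne_theta_monomial (V : Matrix (Fin n) (Fin n) ℕ) (S : Finset (Fin n)) (m : Fin n →₀ ℕ) :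
    ∃ e' : Fin n →₀ ℕ, (∀ i ∈ S, e' i = 0) ∧
      aeval (fun i : Fin n => if i ∈ S then (1 : MvPolynomial (Fin n) k) else X i)
          (aeval (fun j : Fin n => ∏ i : Fin n, (X i : MvPolynomial (Fin n) k) ^ V i j) (monomial m (1 : k))) =
        monomial e' 1 := by
  refine ⟨Finsupp.equivFunOnFinite.symm fun i => if i ∈ S then 0 else
      (Finsupp.equivFunOnFinite.symm (V.mulVec ⇑m) : Fin n →₀ ℕ) i, fun i hi => ?_, ?_⟩
  · rw [Finsupp.coe_equivFunOnFinite_symm, if_pos hi]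
  · rw [ToricChartFedder.theta_monomial V m (1 : k), substOne_monomial]

/-! ## From plain to logarithmic minors, and the transport theorem -/

/-- Multiplying a plain `2 × 2` Jacobian minor by its two column variables gives the logarithmic minor. [folklore] -/
theorem X_mul_X_mul_minor (P : Fin 2 → MvPolynomial (Fin n) k) (c : Fin 2 → Fin n) :
    (X (c 0) : MvPolynomial (Fin n) k) * X (c 1) * (Matrix.of fun a l => pderiv (c a) (P l)).det =
      (Matrix.of fun a l => (X (c a) : MvPolynomial (Fin n) k) * pderiv (c a) (P l)).det := by
  rw [minor_two, logMinor_two]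
  ring

/-- Ideal bookkeeping: if `x ∈ I + (G_μ)` and `r · G_μ ∈ J` for every generator, then `r · x ∈ I + J`. [folklore] -/
theorem mul_mem_sup_of_forall {R : Type} [CommRing R] {ι : Type} (I J : Ideal R) (G : ι → R) (r x : R)
    (hx : x ∈ I ⊔ Ideal.span (Set.range G)) (hG : ∀ μ, r * G μ ∈ J) : r * x ∈ I ⊔ J := by
  have hle : I ⊔ Ideal.span (Set.range G) ≤ (I ⊔ J).colon {r} := by
    refine sup_le (fun y hy => ?_) (Ideal.span_le.mpr ?_)
    · exact Submodule.mem_colon_singleton.mpr (Ideal.mem_sup_left (I.mul_mem_right _ hy))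
    · rintro _ ⟨μ, rfl⟩
      refine Submodule.mem_colon_singleton.mpr ?_
      rw [smul_eq_mul, mul_comm]
      exact Ideal.mem_sup_right (hG μ)
  have h := Submodule.mem_colon_singleton.mp (hle hx)
  rwa [smul_eq_mul, mul_comm] at h

/-- **THE TRANSPORT THEOREM** (`c = 2`).  From the chart identity `Y^{d_l} · g_l(Y_S = 0) = θ P_l` (`l = 0, 1`) for a unimodular
`V` and an `X`-coordinate cell certificate `X^e ∈ (P₀, P₁) + (2 × 2 minors of P on the column pairs cols μ)`, the `Y`-coordinate
smooth-face certificate entry: `∃ t js e', (∀ i ∈ S, e' i = 0) ∧ Y^{e'} ∈ (g_l(Y_S = 0)) + (2 × 2 minors of g(Y_S = 0))`. [folklore] -/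
theorem hcert_of_cellCertificate (V : Matrix (Fin n) (Fin n) ℕ) (hV : IsUnit (V.map (Nat.cast : ℕ → ℤ)).det)
    (S : Finset (Fin n)) (g P : Fin 2 → MvPolynomial (Fin n) k) (d : Fin 2 → (Fin n →₀ ℕ))
    (hP : ∀ l, monomial (d l) 1 * aeval (fun i : Fin n => if i ∈ S then (0 : MvPolynomial (Fin n) k) else X i) (g l) =
      aeval (fun j : Fin n => ∏ i : Fin n, (X i : MvPolynomial (Fin n) k) ^ V i j) (P l))
    (e : Fin n →₀ ℕ) {t : ℕ} (cols : Fin t → Fin 2 → Fin n)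
    (hcert : (monomial e (1 : k) : MvPolynomial (Fin n) k) ∈
      Ideal.span (Set.range P) ⊔ Ideal.span (Set.range fun μ : Fin t => (Matrix.of fun a l => pderiv (cols μ a) (P l)).det)) :
    ∃ (tt : ℕ) (js : Fin tt → Fin 2 → Fin n) (e' : Fin n →₀ ℕ), (∀ i ∈ S, e' i = 0) ∧
      (monomial e' (1 : k) : MvPolynomial (Fin n) k) ∈
        Ideal.span (Set.range fun l : Fin 2 =>
            aeval (fun i : Fin n => if i ∈ S then (0 : MvPolynomial (Fin n) k) else X i) (g l)) ⊔
          Ideal.span (Set.range fun ν : Fin tt => (Matrix.of fun a l => pderiv (js ν a)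
            (aeval (fun i : Fin n => if i ∈ S then (0 : MvPolynomial (Fin n) k) else X i) (g l))).det) := by
  classical
  -- Step 0: plain → logarithmic minors, multiplying the certificate by `r = ∏_μ X_{cols μ 0} X_{cols μ 1} = X^f`
  have hlog : (∏ μ : Fin t, ((X (cols μ 0) : MvPolynomial (Fin n) k) * X (cols μ 1))) * monomial e (1 : k) ∈
      Ideal.span (Set.range P) ⊔ Ideal.span (Set.range fun μ : Fin t =>
        (Matrix.of fun a l => (X (cols μ a) : MvPolynomial (Fin n) k) * pderiv (cols μ a) (P l)).det) := by
    refine mul_mem_sup_of_forall _ _ _ _ _ hcert fun μ => ?_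
    rw [← Finset.mul_prod_erase Finset.univ _ (Finset.mem_univ μ), mul_comm, ← mul_assoc, mul_comm _ (X (cols μ 0) * _),
      X_mul_X_mul_minor]
    exact Ideal.mul_mem_right _ _ (Ideal.subset_span ⟨μ, rfl⟩)
  have hprod : (∏ μ : Fin t, ((X (cols μ 0) : MvPolynomial (Fin n) k) * X (cols μ 1))) * monomial e (1 : k) =
      monomial (∑ μ : Fin t, (Finsupp.single (cols μ 0) 1 + Finsupp.single (cols μ 1) 1) + e) 1 := by
    rw [show (monomial (∑ μ : Fin t, (Finsupp.single (cols μ 0) 1 + Finsupp.single (cols μ 1) 1) + e) (1 : k) :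
          MvPolynomial (Fin n) k) =
        monomial (∑ μ : Fin t, (Finsupp.single (cols μ 0) 1 + Finsupp.single (cols μ 1) 1)) 1 * monomial e 1 by
          rw [monomial_mul, one_mul], monomial_sum_index, C_1, one_mul]
    congr 1
    refine Finset.prod_congr rfl fun μ _ => ?_
    rw [X, X, monomial_mul, one_mul]
  rw [hprod] at hlog
  -- Step 1: the image of the logarithmic certificate under `φ = (Y_S ↦ 1) ∘ θ` is a monomial supported off `S`
  obtain ⟨e', he', hφ⟩ := substOne_theta_monomial (k := k) V S
    (∑ μ : Fin t, (Finsupp.single (cols μ 0) 1 + Finsupp.single (cols μ 1) 1) + e)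
  refine ⟨n * n, fun ν => ![(finProdFinEquiv.symm ν).1, (finProdFinEquiv.symm ν).2], e', he', ?_⟩
  rw [← hφ]
  -- Step 2: `Y_S ↦ 1` maps `(h) + (all 2 × 2 minors of h)` into the target, `h_l = g_l(Y_S = 0)`
  have hσ : Ideal.span (Set.range fun l : Fin 2 =>
        aeval (fun i : Fin n => if i ∈ S then (0 : MvPolynomial (Fin n) k) else X i) (g l)) ⊔
      Ideal.span (Set.range fun ii' : Fin n × Fin n => (Matrix.of fun a l => pderiv (![ii'.1, ii'.2] a)
        (aeval (fun i : Fin n => if i ∈ S then (0 : MvPolynomial (Fin n) k) else X i) (g l))).det) ≤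
      (Ideal.span (Set.range fun l : Fin 2 =>
          aeval (fun i : Fin n => if i ∈ S then (0 : MvPolynomial (Fin n) k) else X i) (g l)) ⊔
        Ideal.span (Set.range fun ν : Fin (n * n) => (Matrix.of fun a l =>
          pderiv (![(finProdFinEquiv.symm ν).1, (finProdFinEquiv.symm ν).2] a)
            (aeval (fun i : Fin n => if i ∈ S then (0 : MvPolynomial (Fin n) k) else X i) (g l))).det)).comap
      (aeval (fun i : Fin n => if i ∈ S then (1 : MvPolynomial (Fin n) k) else X i)) := by
    refine sup_le (Ideal.span_le.mpr ?_) (Ideal.span_le.mpr ?_)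
    · rintro _ ⟨l, rfl⟩
      rw [SetLike.mem_coe, Ideal.mem_comap, substOne_substZero]
      exact Ideal.mem_sup_left (Ideal.subset_span ⟨l, rfl⟩)
    · rintro _ ⟨ii', rfl⟩
      rw [SetLike.mem_coe, Ideal.mem_comap, substOne_minor_substZero]
      refine Ideal.mem_sup_right (Ideal.subset_span ⟨finProdFinEquiv ii', ?_⟩)
      simp only [Equiv.symm_apply_apply]
  -- Step 3: `φ` maps the logarithmic certificate ideal into the target
  have hle : Ideal.span (Set.range P) ⊔ Ideal.span (Set.range fun μ : Fin t =>
        (Matrix.of fun a l => (X (cols μ a) : MvPolynomial (Fin n) k) * pderiv (cols μ a) (P l)).det) ≤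
      ((Ideal.span (Set.range fun l : Fin 2 =>
          aeval (fun i : Fin n => if i ∈ S then (0 : MvPolynomial (Fin n) k) else X i) (g l)) ⊔
        Ideal.span (Set.range fun ν : Fin (n * n) => (Matrix.of fun a l =>
          pderiv (![(finProdFinEquiv.symm ν).1, (finProdFinEquiv.symm ν).2] a)
            (aeval (fun i : Fin n => if i ∈ S then (0 : MvPolynomial (Fin n) k) else X i) (g l))).det)).comap
        (aeval (fun i : Fin n => if i ∈ S then (1 : MvPolynomial (Fin n) k) else X i))).comap
      (aeval (fun j : Fin n => ∏ i : Fin n, (X i : MvPolynomial (Fin n) k) ^ V i j)) := by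
    refine sup_le (Ideal.span_le.mpr ?_) (Ideal.span_le.mpr ?_)
    · rintro _ ⟨l, rfl⟩
      rw [SetLike.mem_coe, Ideal.mem_comap, Ideal.mem_comap, ← hP l, map_mul, substOne_substZero]
      exact Ideal.mem_sup_left (Ideal.mul_mem_left _ _ (Ideal.subset_span ⟨l, rfl⟩))
    · rintro _ ⟨μ, rfl⟩
      rw [SetLike.mem_coe, Ideal.mem_comap, Ideal.mem_comap]
      exact hσ (theta_logMinor_mem_sup V hV P _ d (fun l => (hP l).symm) (cols μ))
  have h := hle hlog
  rw [Ideal.mem_comap, Ideal.mem_comap] at h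
  exact h

end Summit.ResolutionOfSingularities.ResolutionOfSingularities.Theorems.FInjectiveMacaulayfication.CIThetaTransport

end
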